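import Summits.AtomisticToContinuum.FouriersLaw.Theorems.PhononMeanFreePathDefs
import Summits.AtomisticToContinuum.FouriersLaw.Theorems.PhononMeanFreePathBoundaryKubo

/-!
# `FouriersLaw ↔` the Kubo-form Fourier law, now that `NessUnique` and `BoundaryKubo` are theorems

Route `PhononMeanFreePath` (sub-problem `FouriersLaw`, summit `AtomisticToContinuum`); written by the line lead of crux
`IncoherentChannel` (stmt-AtomisticToContinuum-11811, line `two-horizons-forecast-loss`) as the route-level census after
2026-08-16: `NessUnique` is proved (`NessUnique_holds`), `BoundaryKubo` is proved (`boundaryKubo_proof`, item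
stmt-AtomisticToContinuum-11812), and existence of weak steady states is the proved fact
`pinnedChain_exists_isSteadyState`. With these, the sub-problem conjunct is EQUIVALENT to the KUBO-FORM FOURIER LAW

  `KuboForm : ∀ ω₂ lam β γ > 0, ∀ T > 0, ∃ κ > 0, N·(γ²/T²)·∫₀^∞ C_N(t) dt → κ`,
  `C_N(t) = powerCov ω₂ lam β γ T N t = Cov_{μ₀}(p_0², K_t p_N²)` (route Defs; VERBATIM the kernel of `BoundaryKubo`),

an equilibrium-dynamics statement about the constructed kernels with no steady-state family, no `δ`-limit and no
cumulant in it (`fouriersLaw_iff_kuboForm`). Reading: the two cruxes `CoherentDephasing` / `IncoherentChannel` of the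
route SPLIT this Kubo form into its coherent part `2(γ²/T²)N∫r_N²` and the cumulant part; for the conjunct itself the
split is a detour — what is left of Fourier's law for the pinned anharmonic chain is exactly existence and positivity
of `lim_N N(γ²/T²)∫₀^∞ C_N`.

* `fouriersLaw_of_kuboForm` — (←): clause (i) from existence + `NessUnique_holds`; clause (ii) with
  `D 0 = 0` (`totalCurrent_zero`), `D (N+1) = N(γ²/T²)∫C_N` (limit = `boundaryKubo_proof`), `D → κ(T)` by re-indexing.
* `kuboForm_of_fouriersLaw` — (→): along the canonical steady-state family (choice on the existence fact) Fourier's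
  law gives `D_N → κ(T) > 0`, and `boundaryKubo_proof` identifies `D_{N+1}` with `N(γ²/T²)∫C_N` (`tendsto_nhds_unique`).
* `fouriersLaw_iff_kuboForm`.

No definition (the Kubo form is written out in each signature), no `sorry`, axioms standard, UNCONDITIONAL.
-/

noncomputable section

open MeasureTheory Set Filter Topology
open scoped NNReal

namespace Summit.AtomisticToContinuum.FouriersLaw.Theorems.PhononMeanFreePath

open Literature.MathematicalPhysics.KineticTheory.HeatConduction
open Summit.AtomisticToContinuum.FouriersLaw.Theses.PhononMeanFreePath (NessUnique_holds)
open Summit.AtomisticToContinuum.FouriersLaw.Theorems.PhononMeanFreePathBoundaryKubo (boundaryKubo_proof)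

/-- **(←) The Kubo-form Fourier law implies the conjunct `FouriersLaw`** (glue over the proved `NessUnique_holds`,
`boundaryKubo_proof`, `pinnedChain_exists_isSteadyState`, `totalCurrent_zero`). [folklore] -/
theorem fouriersLaw_of_kuboForm : (∀ ω₂ lam β γ : ℝ, 0 < ω₂ → 0 < lam → 0 < β → 0 < γ → ∀ T : ℝ, 0 < T → ∃ κ : ℝ, 0 < κ ∧ Tendsto (fun N : ℕ => (N : ℝ) * (γ ^ 2 / T ^ 2) * ∫ t in Ioi (0 : ℝ), powerCov ω₂ lam β γ T N t) atTop (𝓝 κ)) → _root_.FouriersLaw := by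
  intro hK
  show ∀ ω₂ lam β γ : ℝ, 0 < ω₂ → 0 < lam → 0 < β → 0 < γ → (pinnedChain ω₂ lam β γ).FouriersLawFor
  intro ω₂ lam β γ hω hl hβ hγ
  have huniq := NessUnique_holds ω₂ lam β γ hω hl hβ hγ
  refine ⟨fun N T_L T_R hL hR => ?_, ?_⟩
  · obtain ⟨μ, hμ⟩ := pinnedChain_exists_isSteadyState hω hl hβ hγ N hL hR
    exact ⟨μ, hμ, fun ν hν => huniq N T_L T_R hL hR ν μ hν hμ⟩
  choose κf hκpos hκlim using (fun (T : ℝ) (hT : 0 < T) => hK ω₂ lam β γ hω hl hβ hγ T hT)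
  refine ⟨fun T => if hT : 0 < T then κf T hT else 1, fun T hT => ?_, ?_⟩
  · simp only [dif_pos hT]
    exact hκpos T hT
  intro μ hμ T hT
  have hKT := boundaryKubo_proof ω₂ lam β γ hω hl hβ hγ huniq μ hμ T hT
  -- the response coefficients: D 0 = 0 (empty chain), D (N+1) = N (γ²/T²) ∫ C_N
  let D : ℕ → ℝ := fun M => ((M - 1 : ℕ) : ℝ) * (γ ^ 2 / T ^ 2) * ∫ t in Ioi (0 : ℝ), powerCov ω₂ lam β γ T (M - 1) t
  refine ⟨D, fun M => ?_, ?_⟩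
  · cases M with
    | zero =>
      have h0 : D 0 = 0 := by simp [D]
      rw [h0]
      simp only [OscillatorChain.totalCurrent_zero, zero_div]
      exact tendsto_const_nhds
    | succ N =>
      have hN : D (N + 1) = (N : ℝ) * (γ ^ 2 / T ^ 2) * ∫ t in Ioi (0 : ℝ), powerCov ω₂ lam β γ T N t := by
        simp [D]
      rw [hN]
      exact (hKT N).2
  · simp only [dif_pos hT]
    rw [← tendsto_add_atTop_iff_nat 1]
    have h : ∀ N : ℕ, D (N + 1) = (N : ℝ) * (γ ^ 2 / T ^ 2) * ∫ t in Ioi (0 : ℝ), powerCov ω₂ lam β γ T N t := by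
      intro N
      simp [D]
    simp_rw [h]
    exact hκlim T hT

/-- **(→) The conjunct `FouriersLaw` implies the Kubo-form Fourier law**: along the canonical steady-state family
(choice on `pinnedChain_exists_isSteadyState`; junk `0` off the positive quadrant) `D_N → κ(T) > 0`, and
`boundaryKubo_proof` identifies `D_{N+1} = N(γ²/T²)∫₀^∞ C_N`. [folklore] -/
theorem kuboForm_of_fouriersLaw (hF : _root_.FouriersLaw) : ∀ ω₂ lam β γ : ℝ, 0 < ω₂ → 0 < lam → 0 < β → 0 < γ → ∀ T : ℝ, 0 < T → ∃ κ : ℝ, 0 < κ ∧ Tendsto (fun N : ℕ => (N : ℝ) * (γ ^ 2 / T ^ 2) * ∫ t in Ioi (0 : ℝ), powerCov ω₂ lam β γ T N t) atTop (𝓝 κ) := by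
  intro ω₂ lam β γ hω hl hβ hγ T hT
  obtain ⟨-, κ, hκpos, hκ⟩ := hF ω₂ lam β γ hω hl hβ hγ
  classical
  let μ : (N : ℕ) → ℝ → ℝ → Measure (PhaseSpace N) := fun N T_L T_R =>
    if h : 0 < T_L ∧ 0 < T_R then
      Classical.choose (pinnedChain_exists_isSteadyState hω hl hβ hγ N h.1 h.2) else 0
  have hμ : ∀ (N : ℕ) (T_L T_R : ℝ), 0 < T_L → 0 < T_R →
      (pinnedChain ω₂ lam β γ).IsSteadyState N T_L T_R (μ N T_L T_R) := by
    intro N T_L T_R hL hR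
    simp only [μ, dif_pos (And.intro hL hR)]
    exact Classical.choose_spec (pinnedChain_exists_isSteadyState hω hl hβ hγ N hL hR)
  obtain ⟨D, hD, hDlim⟩ := hκ μ hμ T hT
  have huniq := NessUnique_holds ω₂ lam β γ hω hl hβ hγ
  have hKT := boundaryKubo_proof ω₂ lam β γ hω hl hβ hγ huniq μ hμ T hT
  have hDK : ∀ N : ℕ, D (N + 1) = (N : ℝ) * (γ ^ 2 / T ^ 2) * ∫ t in Ioi (0 : ℝ), powerCov ω₂ lam β γ T N t :=
    fun N => tendsto_nhds_unique (hD (N + 1)) (hKT N).2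
  refine ⟨κ T, hκpos T hT, ?_⟩
  have h := hDlim.comp (tendsto_add_atTop_nat 1)
  refine h.congr fun N => ?_
  simp only [Function.comp_apply, hDK]

/-- **`FouriersLaw ↔` Kubo-form Fourier law** for the pinned anharmonic chain: after `NessUnique_holds` and
`boundaryKubo_proof`, the sub-problem conjunct is exactly the existence and positivity of
`lim_N N(γ²/T²)∫₀^∞ Cov_{μ₀}(p_0², K_t p_N²) dt` at every parameter point. [folklore] -/
theorem fouriersLaw_iff_kuboForm : _root_.FouriersLaw ↔ (∀ ω₂ lam β γ : ℝ, 0 < ω₂ → 0 < lam → 0 < β → 0 < γ → ∀ T : ℝ, 0 < T → ∃ κ : ℝ, 0 < κ ∧ Tendsto (fun N : ℕ => (N : ℝ) * (γ ^ 2 / T ^ 2) * ∫ t in Ioi (0 : ℝ), powerCov ω₂ lam β γ T N t) atTop (𝓝 κ)) :=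
  ⟨kuboForm_of_fouriersLaw, fouriersLaw_of_kuboForm⟩

end Summit.AtomisticToContinuum.FouriersLaw.Theorems.PhononMeanFreePath

end
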